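import Summits.CriticalPhenomena.PercolationContinuityZ3.Theorems.SahiMasterFamilyThreePartitionTypedSliceKernel
import Summits.CriticalPhenomena.PercolationContinuityZ3.Theorems.PercNearOneGluingNoHeavyLowerTailThreePartitionVOrderReverseNested
import HarnessLib

/-!
# The TYPED SLICE, III: the full atom bank of the type-space certificates — `e`-free lifts, mask families, IH / THEOREM-A /
# CONJ-V-nested atoms (unit `prim-master-conj`, gen 34; `--supports stmt-CriticalPhenomena-4575`)

Companion of `…TypedSlice`, `…TypedSliceKernel` (memo `run/shared/lean/prim/prim-l12/prim-master-conj/POINTWISE.md` §34–35,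
certificates `prim-master-conj/code-g33/certs/*.json`, generator/verifier `code/gencert.py` of gen 34).
* `tri_efree_eq_three_mul`: a count reading only the three types is `3 ×` its pinned version (`tri_eq_three_mul_pin`).
* MASKS: a type family as a 27-bit mask `inM M` (bit `idx t`), a pair family as a 729-bit mask `inP Y` (bit `27·idx s + idx t`);
  Boolean checkers `monoM`, `monoP` (closure under the elementary increments `inc`, hence up-sets: `mono_of_inc`), `subM`;
  monotone masks induce up-sets of sets / of the copy order on pairs (`isUpperSet_inM`, `isUpperSet_inP`).
* IH atoms `atomNt th₀ th₁ th₂` = the pattern of a triple of principal type-up-sets `thrSet th` (lifted lattice sections, read in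
  section language by `mem_thrSet`): `threePartNT τ (thrSet th₀) (thrSet th₁) (thrSet th₂) = 3 · tsumP (atomNt …)`.
* THEOREM-A atoms `atomTA G H σ Y` ≥ 0 (`tsumP_atomTA_nonneg`) from the tree's `triT_robust_le` (prim-bnk-2's one-sided robust
  matching, `…ThreePartitionVOrderReverseNested`), localised to a copy-order up-set `Y` of type pairs with a type-level side function.
* CONJ-V-NESTED atoms `atomCV V W Y` ≥ 0 (`tsumP_atomCV_nonneg`) from the tree's `vSumT_nonneg_of_nested` (Conjecture V on nested
  pairs, prim-bnk-2 g24/g25), localised likewise; and mask Kleitman atoms `atomKLm`.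
No `sorry`, standard axioms.  HONEST LABEL: a framework — it proves nothing about the crux by itself. [this work]
-/

noncomputable section

open Finset
open scoped symmDiff Classical

namespace Summit.CriticalPhenomena.PercolationContinuityZ3.Theorems.ThreePartition

namespace TypedSlice

variable {ι : Type*}

/-! ## `e`-free type predicates, masks, and the full atom bank (IH / Theorem-A / CONJ-V-nested) -/

section Atoms

variable [Fintype ι] (𝒰 𝒱 𝒲 : Set (Set ι)) (e : ι) (τ : Set ι)

/-- An `e`-FREE count (the predicate reads only the three types) is three times its pinned version. [this work] -/
theorem tri_efree_eq_three_mul (Q : Ty → Ty → Ty → Bool) :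
    ((tri fun S₁ S₂ S₃ => Q (typ 𝒰 𝒱 𝒲 e (S₁ ∆ τ)) (typ 𝒰 𝒱 𝒲 e (S₂ ∆ τ)) (typ 𝒰 𝒱 𝒲 e (S₃ ∆ τ)) = true : ℕ) : ℤ)
      = 3 * tsumP 𝒰 𝒱 𝒲 e τ (fun a b c => bz (Q a b c)) := by
  rw [tri_eq_three_mul_pin e (fun S₁ S₂ S₃ =>
    Q (typ 𝒰 𝒱 𝒲 e (S₁ ∆ τ)) (typ 𝒰 𝒱 𝒲 e (S₂ ∆ τ)) (typ 𝒰 𝒱 𝒲 e (S₃ ∆ τ)) = true)]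
  · push_cast
    rw [tri_pin_eq_tsumP 𝒰 𝒱 𝒲 e τ Q]
  · intro S₁ S₂ S₃; simp only [typ_insert_symmDiff, typ_sdiff_symmDiff]
  · intro S₁ S₂ S₃; simp only [typ_insert_symmDiff, typ_sdiff_symmDiff]

/-- Membership of a type in a type family given as a 27-bit MASK (bit `idx t`). [this work] -/
def inM (M : ℕ) (t : Ty) : Bool := M.testBit (idx t)

/-- Membership of a pair of types in a pair family given as a 729-bit MASK (bit `27 · idx s + idx t`). [this work] -/
def inP (Y : ℕ) (s t : Ty) : Bool := Y.testBit (27 * idx s + idx t)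

/-- One level up (saturating). [this work] -/
def up : Fin 3 → Fin 3
  | 0 => 1
  | 1 => 2
  | 2 => 2

/-- Elementary increment of coordinate `i` of a type. [this work] -/
def inc (i : Fin 3) (t : Ty) : Ty := match i with
  | 0 => (up t.1, t.2.1, t.2.2)
  | 1 => (t.1, up t.2.1, t.2.2)
  | 2 => (t.1, t.2.1, up t.2.2)

/-- A Boolean type family closed under the elementary increments is an up-set of the componentwise order. [this work] -/
theorem mono_of_inc {F : Ty → Bool} (h : ∀ (t : Ty) (i : Fin 3), F t = true → F (inc i t) = true) {s t : Ty}
    (hst : ge3 t s = true) (hs : F s = true) : F t = true := by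
  obtain ⟨a, b, c⟩ := s
  obtain ⟨a', b', c'⟩ := t
  simp only [ge3, Bool.and_eq_true, decide_eq_true_eq] at hst
  obtain ⟨ha, hb, hc⟩ := hst
  have k1 : ∀ (x y b c : Fin 3), x ≤ y → F (x, b, c) = true → F (y, b, c) = true := by
    intro x y b c hxy hF
    have h1 : ∀ z : Fin 3, F (z, b, c) = true → F (up z, b, c) = true := fun z hz => h (z, b, c) 0 hz
    fin_cases x <;> fin_cases y <;>
      first | exact hF | exact h1 0 hF | exact h1 1 hF | exact h1 1 (h1 0 hF) | exact absurd hxy (by decide)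
  have k2 : ∀ (x y a c : Fin 3), x ≤ y → F (a, x, c) = true → F (a, y, c) = true := by
    intro x y a c hxy hF
    have h1 : ∀ z : Fin 3, F (a, z, c) = true → F (a, up z, c) = true := fun z hz => h (a, z, c) 1 hz
    fin_cases x <;> fin_cases y <;>
      first | exact hF | exact h1 0 hF | exact h1 1 hF | exact h1 1 (h1 0 hF) | exact absurd hxy (by decide)
  have k3 : ∀ (x y a b : Fin 3), x ≤ y → F (a, b, x) = true → F (a, b, y) = true := by
    intro x y a b hxy hF
    have h1 : ∀ z : Fin 3, F (a, b, z) = true → F (a, b, up z) = true := fun z hz => h (a, b, z) 2 hz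
    fin_cases x <;> fin_cases y <;>
      first | exact hF | exact h1 0 hF | exact h1 1 hF | exact h1 1 (h1 0 hF) | exact absurd hxy (by decide)
  exact k3 c c' a' b' hc (k2 b b' a' c hb (k1 a a' b c ha hs))

/-- Checker: the mask `M` is an up-set of types. [this work] -/
def monoM (M : ℕ) : Bool := tyList.all fun t => f3.all fun i => !inM M t || inM M (inc i t)

/-- Checker: the pair mask `Y` is an up-set of the componentwise order on pairs of types. [this work] -/
def monoP (Y : ℕ) : Bool :=
  tyList.all fun s => tyList.all fun t => f3.all fun i => !inP Y s t || (inP Y (inc i s) t && inP Y s (inc i t))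

/-- Checker: mask inclusion. [this work] -/
def subM (M N : ℕ) : Bool := tyList.all fun t => !inM M t || inM N t

/-- Every level is listed. [this work] -/
theorem mem_f3 (i : Fin 3) : i ∈ f3 := by fin_cases i <;> simp [f3]

/-- Soundness of `monoM`. [this work] -/
theorem inM_mono {M : ℕ} (hM : monoM M = true) {s t : Ty} (hst : ge3 t s = true) (hs : inM M s = true) : inM M t = true := by
  refine mono_of_inc (fun t i ht => ?_) hst hs
  unfold monoM at hM
  simp only [List.all_eq_true] at hM
  have := hM t (mem_tyList t) i (mem_f3 i)
  simpa [ht] using this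

/-- Soundness of `monoP`. [this work] -/
theorem inP_mono {Y : ℕ} (hY : monoP Y = true) {s s' t t' : Ty} (hs : ge3 s' s = true) (ht : ge3 t' t = true)
    (hst : inP Y s t = true) : inP Y s' t' = true := by
  unfold monoP at hY
  simp only [List.all_eq_true] at hY
  have hY' : ∀ (x y : Ty) (i : Fin 3), inP Y x y = true → inP Y (inc i x) y = true ∧ inP Y x (inc i y) = true :=
    fun x y i hxy => by simpa [hxy] using hY x (mem_tyList x) y (mem_tyList y) i (mem_f3 i)
  have h1 : inP Y s' t = true := mono_of_inc (F := fun x => inP Y x t) (fun x i hx => (hY' x t i hx).1) hs hst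
  exact mono_of_inc (F := fun y => inP Y s' y) (fun y i hy => (hY' s' y i hy).2) ht h1

/-- Soundness of `subM`. [this work] -/
theorem inM_of_subM {M N : ℕ} (h : subM M N = true) {t : Ty} (ht : inM M t = true) : inM N t = true := by
  unfold subM at h
  simp only [List.all_eq_true] at h
  simpa [ht] using h t (mem_tyList t)

omit [Fintype ι] in
/-- Types are monotone in the set. [this work] -/
theorem ge3_typ_mono (h𝒰 : IsUpperSet 𝒰) (h𝒱 : IsUpperSet 𝒱) (h𝒲 : IsUpperSet 𝒲) {w w' : Set ι} (h : w ⊆ w') :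
    ge3 (typ 𝒰 𝒱 𝒲 e w') (typ 𝒰 𝒱 𝒲 e w) = true := by
  simp only [ge3, typ, Bool.and_eq_true, decide_eq_true_eq]
  exact ⟨tyAt_mono h𝒰 e h, tyAt_mono h𝒱 e h, tyAt_mono h𝒲 e h⟩

omit [Fintype ι] in
/-- A monotone mask gives an up-set of sets. [this work] -/
theorem isUpperSet_inM (h𝒰 : IsUpperSet 𝒰) (h𝒱 : IsUpperSet 𝒱) (h𝒲 : IsUpperSet 𝒲) {M : ℕ} (hM : monoM M = true) :
    IsUpperSet {w : Set ι | inM M (typ 𝒰 𝒱 𝒲 e w) = true} :=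
  fun _ _ hww' hw => inM_mono hM (ge3_typ_mono 𝒰 𝒱 𝒲 e h𝒰 h𝒱 h𝒲 hww') hw

omit [Fintype ι] in
/-- A monotone pair mask gives an up-set of the copy order on pairs of sets. [this work] -/
theorem isUpperSet_inP (h𝒰 : IsUpperSet 𝒰) (h𝒱 : IsUpperSet 𝒱) (h𝒲 : IsUpperSet 𝒲) {Y : ℕ} (hY : monoP Y = true) :
    IsUpperSet {q : Set ι × Set ι | inP Y (typ 𝒰 𝒱 𝒲 e q.1) (typ 𝒰 𝒱 𝒲 e q.2) = true} :=
  fun _ _ hle hq => inP_mono hY (ge3_typ_mono 𝒰 𝒱 𝒲 e h𝒰 h𝒱 h𝒲 hle.1) (ge3_typ_mono 𝒰 𝒱 𝒲 e h𝒰 h𝒱 h𝒲 hle.2) hq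

/-- The principal type-up-set `{w | typ w ≥ th}` of a threshold, as a family of sets ("lifted lattice section"). [this work] -/
def thrSet (th : Ty) : Set (Set ι) := {w : Set ι | ge3 (typ 𝒰 𝒱 𝒲 e w) th = true}

omit [Fintype ι] in
/-- Reading a level requirement `l ≤ tyAt 𝒳 e w` in section language: level `2` = the deletion section `w ∖ e ∈ 𝒳`,
level `1` = the contraction section `w ∪ e ∈ 𝒳` (for an up-set), level `0` = no condition. [this work] -/
theorem le_tyAt_iff {𝒳 : Set (Set ι)} (h𝒳 : IsUpperSet 𝒳) (w : Set ι) (l : Fin 3) :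
    l ≤ tyAt 𝒳 e w ↔ (l = 1 → insert e w ∈ 𝒳) ∧ (l = 2 → w \ {e} ∈ 𝒳) := by
  have h1 := one_le_tyAt_iff h𝒳 e w
  have h2 := tyAt_eq_two_iff 𝒳 e w
  have h3 : tyAt 𝒳 e w ≤ 2 := Fin.le_last _
  fin_cases l
  · simp
  · simp only [Fin.mk_one, h1, forall_const]
    constructor
    · intro h; exact ⟨h, fun h' => absurd h' (by decide)⟩
    · intro h; exact h.1
  · simp only [Fin.reduceFinMk, Fin.reduceEq, false_implies, true_implies, true_and, ← h2]
    constructor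
    · intro h; exact le_antisymm h3 h
    · intro h; exact h.ge

omit [Fintype ι] in
/-- Membership in a threshold family, in section language. [this work] -/
theorem mem_thrSet (h𝒰 : IsUpperSet 𝒰) (h𝒱 : IsUpperSet 𝒱) (h𝒲 : IsUpperSet 𝒲) (th : Ty) (w : Set ι) :
    w ∈ thrSet 𝒰 𝒱 𝒲 e th ↔
      ((th.1 = 1 → insert e w ∈ 𝒰) ∧ (th.1 = 2 → w \ {e} ∈ 𝒰)) ∧
      ((th.2.1 = 1 → insert e w ∈ 𝒱) ∧ (th.2.1 = 2 → w \ {e} ∈ 𝒱)) ∧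
      ((th.2.2 = 1 → insert e w ∈ 𝒲) ∧ (th.2.2 = 2 → w \ {e} ∈ 𝒲)) := by
  simp only [thrSet, Set.mem_setOf_eq, ge3, typ, Bool.and_eq_true, decide_eq_true_eq, le_tyAt_iff e h𝒰,
    le_tyAt_iff e h𝒱, le_tyAt_iff e h𝒲]

/-- The IH atom: the three-partition pattern of a triple of principal type-up-sets, one position. [this work] -/
def atomNt (th₀ th₁ th₂ : Ty) (ta tb tc : Ty) : ℤ :=
  kerK (ge3 ta th₀) (ge3 ta th₁) (ge3 ta th₂) (ge3 tb th₁) (ge3 tc th₀) (ge3 tc th₁) (ge3 tc th₂)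

/-- **IH atoms**: the twisted functional of a triple of threshold families is `3 · tsumP (atomNt th₀ th₁ th₂)`. [this work] -/
theorem threePartNT_thrSet_eq_tsumP (th₀ th₁ th₂ : Ty) :
    threePartNT τ (thrSet 𝒰 𝒱 𝒲 e th₀) (thrSet 𝒰 𝒱 𝒲 e th₁) (thrSet 𝒰 𝒱 𝒲 e th₂)
      = 3 * tsumP 𝒰 𝒱 𝒲 e τ (atomNt th₀ th₁ th₂) := by
  rw [threePartNT_eq_tsumP 𝒰 𝒱 𝒲 e τ (fun _ t => ge3 t th₀) (fun _ t => ge3 t th₁) (fun _ t => ge3 t th₂), ← tsumP_const_mul]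
  · exact tsumP_congr 𝒰 𝒱 𝒲 e τ fun ta tb tc => by rw [kappaR_const]; rfl
  · intro x _ _; exact Iff.rfl
  · intro x _ _; exact Iff.rfl
  · intro x _ _; exact Iff.rfl

/-- From an IH in functional form to the pinned atom. [this work] -/
theorem tsumP_atomNt_nonneg_of (th₀ th₁ th₂ : Ty)
    (h : 0 ≤ threePartNT τ (thrSet 𝒰 𝒱 𝒲 e th₀) (thrSet 𝒰 𝒱 𝒲 e th₁) (thrSet 𝒰 𝒱 𝒲 e th₂)) :
    0 ≤ tsumP 𝒰 𝒱 𝒲 e τ (atomNt th₀ th₁ th₂) := by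
  rw [threePartNT_thrSet_eq_tsumP] at h
  linarith

/-- The THEOREM-A atom `TA(G, H, σ, Y)`: `[(t_a,t_b) ∈ Y]·([t_c ∉ H][t_{σ(t_c)} ∈ G] − [t_c ∈ G][t_a ∉ H])`, the side `σ(t_c)`
being `b` iff the bit of `t_c` in the mask `σ` is set. [this work] -/
def atomTA (G H σ Y : ℕ) (ta tb tc : Ty) : ℤ :=
  bz (inP Y ta tb && (!inM H tc && (bif inM σ tc then inM G tb else inM G ta)))
    - bz (inP Y ta tb && (inM G tc && !inM H ta))

/-- **Theorem-A atoms are nonnegative** (the tree's `triT_robust_le` = prim-bnk-2's one-sided robust matching, localised to the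
copy-order up-set `Y` of type pairs, with type families `G, H` and a type-level side function). [this work] -/
theorem tsumP_atomTA_nonneg (h𝒰 : IsUpperSet 𝒰) (h𝒱 : IsUpperSet 𝒱) (h𝒲 : IsUpperSet 𝒲) {G H Y : ℕ} (σ : ℕ)
    (hG : monoM G = true) (hH : monoM H = true) (hY : monoP Y = true) :
    0 ≤ tsumP 𝒰 𝒱 𝒲 e τ (atomTA G H σ Y) := by
  have h := triT_robust_le τ (isUpperSet_inP 𝒰 𝒱 𝒲 e h𝒰 h𝒱 h𝒲 hY) (isUpperSet_inM 𝒰 𝒱 𝒲 e h𝒰 h𝒱 h𝒲 hG)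
    (isUpperSet_inM 𝒰 𝒱 𝒲 e h𝒰 h𝒱 h𝒲 hH) (fun c => inM σ (typ 𝒰 𝒱 𝒲 e c))
  unfold triT at h
  have hL : tri (fun S₁ S₂ S₃ => (S₁ ∆ τ, S₂ ∆ τ) ∈ {q : Set ι × Set ι | inP Y (typ 𝒰 𝒱 𝒲 e q.1) (typ 𝒰 𝒱 𝒲 e q.2) = true}
        ∧ S₃ ∆ τ ∈ {w : Set ι | inM G (typ 𝒰 𝒱 𝒲 e w) = true} ∧ S₁ ∆ τ ∉ {w : Set ι | inM H (typ 𝒰 𝒱 𝒲 e w) = true})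
      = tri (fun S₁ S₂ S₃ => (fun ta tb tc => inP Y ta tb && (inM G tc && !inM H ta))
        (typ 𝒰 𝒱 𝒲 e (S₁ ∆ τ)) (typ 𝒰 𝒱 𝒲 e (S₂ ∆ τ)) (typ 𝒰 𝒱 𝒲 e (S₃ ∆ τ)) = true) :=
    tri_congr fun _ _ _ => by simp only [Set.mem_setOf_eq, Bool.and_eq_true, Bool.not_eq_true', Bool.not_eq_true]
  have hR : tri (fun S₁ S₂ S₃ => (S₁ ∆ τ, S₂ ∆ τ) ∈ {q : Set ι × Set ι | inP Y (typ 𝒰 𝒱 𝒲 e q.1) (typ 𝒰 𝒱 𝒲 e q.2) = true}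
        ∧ S₃ ∆ τ ∉ {w : Set ι | inM H (typ 𝒰 𝒱 𝒲 e w) = true} ∧
        (if inM σ (typ 𝒰 𝒱 𝒲 e (S₃ ∆ τ)) = true then S₂ ∆ τ ∈ {w : Set ι | inM G (typ 𝒰 𝒱 𝒲 e w) = true}
          else S₁ ∆ τ ∈ {w : Set ι | inM G (typ 𝒰 𝒱 𝒲 e w) = true}))
      = tri (fun S₁ S₂ S₃ => (fun ta tb tc => inP Y ta tb && (!inM H tc && (bif inM σ tc then inM G tb else inM G ta)))
        (typ 𝒰 𝒱 𝒲 e (S₁ ∆ τ)) (typ 𝒰 𝒱 𝒲 e (S₂ ∆ τ)) (typ 𝒰 𝒱 𝒲 e (S₃ ∆ τ)) = true) :=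
    tri_congr fun S₁ S₂ _ => by
      cases hσ : inM σ (typ 𝒰 𝒱 𝒲 e ((S₁ ∪ S₂)ᶜ ∆ τ)) <;>
        simp only [Set.mem_setOf_eq, Bool.and_eq_true, Bool.not_eq_true', hσ, cond_true, cond_false,
          Bool.false_eq_true, if_false, if_true, Bool.not_eq_true]
  rw [hL, hR] at h
  have h' := Int.ofNat_le.2 h
  push_cast at h'
  rw [tri_efree_eq_three_mul 𝒰 𝒱 𝒲 e τ (fun ta tb tc => inP Y ta tb && (inM G tc && !inM H ta)),
    tri_efree_eq_three_mul 𝒰 𝒱 𝒲 e τ (fun ta tb tc => inP Y ta tb && (!inM H tc && (bif inM σ tc then inM G tb else inM G ta)))] at h'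
  unfold atomTA
  rw [tsumP_sub]
  linarith

/-- The CONJ-V-NESTED atom `CV(V, W, Y)`: `[(t_a,t_b) ∈ Y]·K_{V,W}`,
`K_{V,W} = 2[a∈VW] + [c∈V][b∈W] − [a∈W][c∈V] − [a∈V][c∈W] − [c∈VW]`. [this work] -/
def atomCV (V W Y : ℕ) (ta tb tc : Ty) : ℤ :=
  2 * bz (inP Y ta tb && (inM V ta && inM W ta)) + bz (inP Y ta tb && (inM V tc && inM W tb))
    - (bz (inP Y ta tb && (inM W ta && inM V tc)) + bz (inP Y ta tb && (inM V ta && inM W tc))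
      + bz (inP Y ta tb && (inM V tc && inM W tc)))

/-- **CONJ-V-nested atoms are nonnegative** (the tree's `vSumT_nonneg_of_nested` = Conjecture V on nested pairs, prim-bnk-2 g24/g25,
localised to the copy-order up-set `Y` of type pairs with NESTED type families `V, W`). [this work] -/
theorem tsumP_atomCV_nonneg (h𝒰 : IsUpperSet 𝒰) (h𝒱 : IsUpperSet 𝒱) (h𝒲 : IsUpperSet 𝒲) {V W Y : ℕ}
    (hV : monoM V = true) (hW : monoM W = true) (hY : monoP Y = true) (hn : (subM V W || subM W V) = true) :
    0 ≤ tsumP 𝒰 𝒱 𝒲 e τ (atomCV V W Y) := by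
  have hsub : {w : Set ι | inM V (typ 𝒰 𝒱 𝒲 e w) = true} ⊆ {w : Set ι | inM W (typ 𝒰 𝒱 𝒲 e w) = true} ∨
      {w : Set ι | inM W (typ 𝒰 𝒱 𝒲 e w) = true} ⊆ {w : Set ι | inM V (typ 𝒰 𝒱 𝒲 e w) = true} := by
    rcases Bool.or_eq_true_iff.1 hn with h | h
    · exact Or.inl fun w hw => inM_of_subM h hw
    · exact Or.inr fun w hw => inM_of_subM h hw
  have h := vSumT_nonneg_of_nested τ (isUpperSet_inM 𝒰 𝒱 𝒲 e h𝒰 h𝒱 h𝒲 hV) (isUpperSet_inM 𝒰 𝒱 𝒲 e h𝒰 h𝒱 h𝒲 hW)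
    (isUpperSet_inP 𝒰 𝒱 𝒲 e h𝒰 h𝒱 h𝒲 hY) hsub
  unfold vSumT triT at h
  have e1 : tri (fun S₁ S₂ S₃ => (S₁ ∆ τ, S₂ ∆ τ) ∈ {q : Set ι × Set ι | inP Y (typ 𝒰 𝒱 𝒲 e q.1) (typ 𝒰 𝒱 𝒲 e q.2) = true}
        ∧ S₁ ∆ τ ∈ {w : Set ι | inM V (typ 𝒰 𝒱 𝒲 e w) = true} ∧ S₁ ∆ τ ∈ {w : Set ι | inM W (typ 𝒰 𝒱 𝒲 e w) = true})
      = tri (fun S₁ S₂ S₃ => (fun ta tb (_ : Ty) => inP Y ta tb && (inM V ta && inM W ta))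
        (typ 𝒰 𝒱 𝒲 e (S₁ ∆ τ)) (typ 𝒰 𝒱 𝒲 e (S₂ ∆ τ)) (typ 𝒰 𝒱 𝒲 e (S₃ ∆ τ)) = true) :=
    tri_congr fun _ _ _ => by simp only [Set.mem_setOf_eq, Bool.and_eq_true]
  have e2 : tri (fun S₁ S₂ S₃ => (S₁ ∆ τ, S₂ ∆ τ) ∈ {q : Set ι × Set ι | inP Y (typ 𝒰 𝒱 𝒲 e q.1) (typ 𝒰 𝒱 𝒲 e q.2) = true}
        ∧ S₃ ∆ τ ∈ {w : Set ι | inM V (typ 𝒰 𝒱 𝒲 e w) = true} ∧ S₂ ∆ τ ∈ {w : Set ι | inM W (typ 𝒰 𝒱 𝒲 e w) = true})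
      = tri (fun S₁ S₂ S₃ => (fun ta tb tc => inP Y ta tb && (inM V tc && inM W tb))
        (typ 𝒰 𝒱 𝒲 e (S₁ ∆ τ)) (typ 𝒰 𝒱 𝒲 e (S₂ ∆ τ)) (typ 𝒰 𝒱 𝒲 e (S₃ ∆ τ)) = true) :=
    tri_congr fun _ _ _ => by simp only [Set.mem_setOf_eq, Bool.and_eq_true]
  have e3 : tri (fun S₁ S₂ S₃ => (S₁ ∆ τ, S₂ ∆ τ) ∈ {q : Set ι × Set ι | inP Y (typ 𝒰 𝒱 𝒲 e q.1) (typ 𝒰 𝒱 𝒲 e q.2) = true}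
        ∧ S₁ ∆ τ ∈ {w : Set ι | inM W (typ 𝒰 𝒱 𝒲 e w) = true} ∧ S₃ ∆ τ ∈ {w : Set ι | inM V (typ 𝒰 𝒱 𝒲 e w) = true})
      = tri (fun S₁ S₂ S₃ => (fun ta tb tc => inP Y ta tb && (inM W ta && inM V tc))
        (typ 𝒰 𝒱 𝒲 e (S₁ ∆ τ)) (typ 𝒰 𝒱 𝒲 e (S₂ ∆ τ)) (typ 𝒰 𝒱 𝒲 e (S₃ ∆ τ)) = true) :=
    tri_congr fun _ _ _ => by simp only [Set.mem_setOf_eq, Bool.and_eq_true]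
  have e4 : tri (fun S₁ S₂ S₃ => (S₁ ∆ τ, S₂ ∆ τ) ∈ {q : Set ι × Set ι | inP Y (typ 𝒰 𝒱 𝒲 e q.1) (typ 𝒰 𝒱 𝒲 e q.2) = true}
        ∧ S₁ ∆ τ ∈ {w : Set ι | inM V (typ 𝒰 𝒱 𝒲 e w) = true} ∧ S₃ ∆ τ ∈ {w : Set ι | inM W (typ 𝒰 𝒱 𝒲 e w) = true})
      = tri (fun S₁ S₂ S₃ => (fun ta tb tc => inP Y ta tb && (inM V ta && inM W tc))
        (typ 𝒰 𝒱 𝒲 e (S₁ ∆ τ)) (typ 𝒰 𝒱 𝒲 e (S₂ ∆ τ)) (typ 𝒰 𝒱 𝒲 e (S₃ ∆ τ)) = true) :=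
    tri_congr fun _ _ _ => by simp only [Set.mem_setOf_eq, Bool.and_eq_true]
  have e5 : tri (fun S₁ S₂ S₃ => (S₁ ∆ τ, S₂ ∆ τ) ∈ {q : Set ι × Set ι | inP Y (typ 𝒰 𝒱 𝒲 e q.1) (typ 𝒰 𝒱 𝒲 e q.2) = true}
        ∧ S₃ ∆ τ ∈ {w : Set ι | inM V (typ 𝒰 𝒱 𝒲 e w) = true} ∧ S₃ ∆ τ ∈ {w : Set ι | inM W (typ 𝒰 𝒱 𝒲 e w) = true})
      = tri (fun S₁ S₂ S₃ => (fun ta tb tc => inP Y ta tb && (inM V tc && inM W tc))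
        (typ 𝒰 𝒱 𝒲 e (S₁ ∆ τ)) (typ 𝒰 𝒱 𝒲 e (S₂ ∆ τ)) (typ 𝒰 𝒱 𝒲 e (S₃ ∆ τ)) = true) :=
    tri_congr fun _ _ _ => by simp only [Set.mem_setOf_eq, Bool.and_eq_true]
  rw [e1, e2, e3, e4, e5] at h
  push_cast at h
  rw [tri_efree_eq_three_mul 𝒰 𝒱 𝒲 e τ (fun ta tb _ => inP Y ta tb && (inM V ta && inM W ta)),
    tri_efree_eq_three_mul 𝒰 𝒱 𝒲 e τ (fun ta tb tc => inP Y ta tb && (inM V tc && inM W tb)),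
    tri_efree_eq_three_mul 𝒰 𝒱 𝒲 e τ (fun ta tb tc => inP Y ta tb && (inM W ta && inM V tc)),
    tri_efree_eq_three_mul 𝒰 𝒱 𝒲 e τ (fun ta tb tc => inP Y ta tb && (inM V ta && inM W tc)),
    tri_efree_eq_three_mul 𝒰 𝒱 𝒲 e τ (fun ta tb tc => inP Y ta tb && (inM V tc && inM W tc))] at h
  have key : tsumP 𝒰 𝒱 𝒲 e τ (atomCV V W Y)
      = 2 * tsumP 𝒰 𝒱 𝒲 e τ (fun a b c => bz (inP Y a b && (inM V a && inM W a)))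
        + tsumP 𝒰 𝒱 𝒲 e τ (fun a b c => bz (inP Y a b && (inM V c && inM W b)))
        - (tsumP 𝒰 𝒱 𝒲 e τ (fun a b c => bz (inP Y a b && (inM W a && inM V c)))
          + tsumP 𝒰 𝒱 𝒲 e τ (fun a b c => bz (inP Y a b && (inM V a && inM W c)))
          + tsumP 𝒰 𝒱 𝒲 e τ (fun a b c => bz (inP Y a b && (inM V c && inM W c)))) := by
    rw [tsumP_comb]; rfl
  rw [key]
  linarith


/-- The typed Kleitman atom with MASK families. [this work] -/
def atomKLm (σ : Ty → Bool) (Y Z : ℕ) : Ty → Ty → Ty → ℤ := atomKLg σ (inM Y) (inM Z)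

/-- Mask Kleitman atoms are nonnegative for monotone masks. [this work] -/
theorem tsumP_atomKLm_nonneg (h𝒰 : IsUpperSet 𝒰) (h𝒱 : IsUpperSet 𝒱) (h𝒲 : IsUpperSet 𝒲) (σ : Ty → Bool) {Y Z : ℕ}
    (hY : monoM Y = true) (hZ : monoM Z = true) : 0 ≤ tsumP 𝒰 𝒱 𝒲 e τ (atomKLm σ Y Z) :=
  tsumP_atomKLg_nonneg 𝒰 𝒱 𝒲 e τ σ _ _ (isUpperSet_inM 𝒰 𝒱 𝒲 e h𝒰 h𝒱 h𝒲 hY) (isUpperSet_inM 𝒰 𝒱 𝒲 e h𝒰 h𝒱 h𝒲 hZ)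

end Atoms

end TypedSlice

end Summit.CriticalPhenomena.PercolationContinuityZ3.Theorems.ThreePartition
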